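/-
Copyright (c) 2026. All rights reserved.
Released under Apache 2.0 license as described in the file LICENSE.
-/
import Mathlib
import Summits.MatrixMultiplication.MatrixMultiplication.Theorems.SubgroupIdentityDesigns.Negative.LevelOneNeumannSqueeze
import Summits.MatrixMultiplication.MatrixMultiplication.Theorems.SubgroupIdentityDesigns.Negative.LevelOneFloorAll

/-!
# `p = 3`: no level-one crux instance in any dimension, for every `0 < ε ≤ 2`

Support file for the crux `LevelGradedCohnUmans.SubgroupIdentityDesigns` (the crux item stays
open; this is a NEGATIVE structural result about its level-one slice `k = 1` over `𝔽_3`,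
uniform in the dimension `m = 1 + l` AND in the exponent `0 < ε ≤ 2`).

`LevelOneSmallPrimes` emptied the level-one slice at `p ≤ 7` in every dimension for `0 < ε ≤ 1`
(the floor there goes through `ℓ^s`-monotonicity, which needs `s = 2 + ε ≤ 3`).  Over `𝔽_3` the
Neumann ceiling is so far below the floor that the DIRECT floor suffices for every `s ≤ 4`:

* floor: the exact level-one degree sum gives `budget ≥ 1 + a^s + b^s > 2 a^s`
  (`a = b − 1 = (3^{1+l} − 3)/2`), so `V^{s/3} > 2 a^s`, i.e. **`V > 2^{3/s} a³ ≥ 2^{3/4} a³ ≥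
  1.6817 a³`** for `s ≤ 4` (`cube_lt_of_rpow_lt`, `rpow_two_three_quarters`);
* ceiling (`LevelOneNeumannSqueeze.levelOne_neumann_master`, valid for EVERY `ε > 0`):
  `V ≤ 2 ((√D_m + 1/2)/√3)³` with `D_m = 1 + a² + b² = 2b² − 2b + 2`, and
  `√D_m + 1/2 ≤ 1.4143 b`, so **`V ≤ 2 (1.4143 b/1.732)³ ≈ 1.089 b³`**;
* for `b ≥ 13` (`l ≥ 2`): `a ≥ (12/13) b` and `1.6817 (12/13)³ ≈ 1.3227 > 1.089` — contradiction
  (`pThree_core`, `no_levelOne_witness_pThree`);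
* `l = 1` (`GL₂(𝔽_3)`, `b = 4`, `D ≤ 26`): the volume law `V ≤ uD − u³ + u²`, `u² ≤ D` gives
  `V ≤ 60`, while `V^{s/3} > 4^s` gives `V > 64` — for EVERY `ε > 0`
  (`no_levelOne_witness_pThree_dimTwo`).

Packaged: **`no_crux_instance_pThree_all (hε : 0 < ε) (hε2 : ε ≤ 2)`: there is no `m ≥ 2` and
no subgroup triple of `GL_m(𝔽_3)` with TPP + a level-one identity design + the crux inequality**
(crux clause verbatim, `k = 1`).  So `p = 3` joins `p = 2` (`PTwoAllDimensions`, every `ε > 0`)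
as a field over which the level-one slice is empty throughout the meaningful exponent range.
(For `ε > 2` and `l ≥ 2` the same argument works whenever `2^{3/2 − 3/s} (1 + 3/(2a))³ < 3√3/2`,
e.g. for all `ε ≤ 2.7`; not recorded.)

Honest framing: VALUE = THEOREM, NOT summit progress.  Sorry-free; standard axioms; no new
definitions.  Report: `run/shared/lean/b2b/levelgraded-cu/ORACLE-g19.md` §G19-4b.
-/

set_option linter.dupNamespace false

noncomputable section

open scoped BigOperators Classical Matrix
open Module (finrank)

namespace Summit.MatrixMultiplication.MatrixMultiplication.Theorems.SubgroupIdentityDesigns.Negative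
namespace PThreeAllDimensions

open Literature.Barriers.MatrixMultiplication (SubgroupTPP)
open Summit.MatrixMultiplication.MatrixMultiplication.Theorems.LieRankDesigns.Negative
  (GLm Mat budget)
open Summit.MatrixMultiplication.MatrixMultiplication.Theorems.LevelOneGL2Designs.Negative
  (levelSubmodule)
open WitnessNeumannCounts (crux_volume_law)
open LevelOneFloorAll (finrank_le_formula_nat)
open LevelOneExact (budget_ge_exact)
open LevelOneNeumannSqueeze (levelOne_neumann_master)

/-! ## Real-number lemmas -/

/-- `1.6817 ≤ 2^{3/4}` (fourth powers: `1.6817⁴ < 8 = (2^{3/4})⁴`). -/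
theorem rpow_two_three_quarters : (1.6817 : ℝ) ≤ (2 : ℝ) ^ ((3 : ℝ) / 4) := by
  have h0 : (0 : ℝ) ≤ (2 : ℝ) ^ ((3 : ℝ) / 4) := Real.rpow_nonneg (by norm_num) _
  have e : ((2 : ℝ) ^ ((3 : ℝ) / 4)) ^ 4 = 8 := by
    rw [← Real.rpow_mul_natCast (by norm_num : (0 : ℝ) ≤ 2),
      show ((3 : ℝ) / 4 * ((4 : ℕ) : ℝ)) = ((3 : ℕ) : ℝ) by norm_num, Real.rpow_natCast]
    norm_num
  by_contra h
  have h' : (2 : ℝ) ^ ((3 : ℝ) / 4) < 1.6817 := not_le.mp h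
  have h4 : ((2 : ℝ) ^ ((3 : ℝ) / 4)) ^ 4 < (1.6817 : ℝ) ^ 4 := pow_lt_pow_left₀ h' h0 (by norm_num)
  rw [e] at h4
  norm_num at h4

/-- From `K a^s < T^{s/3}` (`K, a, T ≥ 0`, `s > 0`) to `K^{3/s} a³ < T`. -/
theorem cube_lt_of_rpow_lt {K a T s : ℝ} (hK : 0 ≤ K) (ha : 0 ≤ a) (hT : 0 ≤ T) (hs : 0 < s)
    (h : K * a ^ s < T ^ (s / 3)) : K ^ (3 / s) * a ^ 3 < T := by
  have hs3 : 0 < s / 3 := by positivity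
  have h33 : (3 / s) * (s / 3) = (1 : ℝ) := by
    rw [div_mul_div_comm, mul_comm (3 : ℝ) s, div_self (by positivity)]
  have hKa : 0 ≤ K ^ (3 / s) * a ^ 3 := mul_nonneg (Real.rpow_nonneg hK _) (pow_nonneg ha 3)
  have e1 : (K ^ (3 / s) * a ^ 3) ^ (s / 3) = K * a ^ s := by
    rw [Real.mul_rpow (Real.rpow_nonneg hK _) (pow_nonneg ha 3), ← Real.rpow_mul hK,
      h33, Real.rpow_one]
    congr 1
    rw [← Real.rpow_natCast a 3, ← Real.rpow_mul ha]
    congr 1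
    push_cast
    ring
  rw [← e1] at h
  exact (Real.rpow_lt_rpow_iff hKa hT hs3).1 h

/-- `√3 ≥ 1.732`. -/
theorem sqrt_three_ge : (1.732 : ℝ) ≤ Real.sqrt 3 := by
  rw [show (1.732 : ℝ) = Real.sqrt (1.732 ^ 2) from (Real.sqrt_sq (by norm_num)).symm]
  exact Real.sqrt_le_sqrt (by norm_num)

/-- **The real-number core at `p = 3`, `b ≥ 13`, `0 < s ≤ 4`**: the master inequality
`1 + a^s + b^s < (2 ((√(1 + a² + b²) + 1/2)/√3)³)^{s/3}` with `a = b − 1` is impossible. -/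
theorem pThree_core {a b s : ℝ} (hb : 13 ≤ b) (hab : a = b - 1) (hs : 0 < s) (hs4 : s ≤ 4)
    (h : 1 + a ^ s + b ^ s <
      (2 * ((Real.sqrt (1 + a ^ 2 + b ^ 2) + 1 / 2) / Real.sqrt 3) ^ 3) ^ (s / 3)) : False := by
  have ha12 : 12 ≤ a := by rw [hab]; linarith
  have ha0 : 0 ≤ a := by linarith
  have hb0 : 0 ≤ b := by linarith
  have hab' : a ≤ b := by rw [hab]; linarith
  have hs0 : 0 ≤ s := hs.le
  set T : ℝ := 2 * ((Real.sqrt (1 + a ^ 2 + b ^ 2) + 1 / 2) / Real.sqrt 3) ^ 3 with hT_def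
  have hs30 : (0 : ℝ) < Real.sqrt 3 := Real.sqrt_pos.2 (by norm_num)
  have hq0 : 0 ≤ (Real.sqrt (1 + a ^ 2 + b ^ 2) + 1 / 2) / Real.sqrt 3 :=
    div_nonneg (by linarith [Real.sqrt_nonneg (1 + a ^ 2 + b ^ 2)]) hs30.le
  have hT0 : 0 ≤ T := by rw [hT_def]; positivity
  -- floor: `2 a^s ≤ 1 + a^s + b^s`
  have has : a ^ s ≤ b ^ s := Real.rpow_le_rpow ha0 hab' hs0
  have h2 : 2 * a ^ s < T ^ (s / 3) := by linarith
  have h3 : (2 : ℝ) ^ (3 / s) * a ^ 3 < T := cube_lt_of_rpow_lt (by norm_num) ha0 hT0 hs h2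
  -- `2^{3/s} ≥ 2^{3/4} ≥ 1.6817`
  have h34 : (3 : ℝ) / 4 ≤ 3 / s := by
    rw [div_le_div_iff₀ (by norm_num) hs]
    linarith
  have h4 : (1.6817 : ℝ) ≤ (2 : ℝ) ^ (3 / s) :=
    rpow_two_three_quarters.trans (Real.rpow_le_rpow_of_exponent_le one_le_two h34)
  have ha3 : 0 ≤ a ^ 3 := pow_nonneg ha0 3
  have h5 : (1.6817 : ℝ) * a ^ 3 < T :=
    lt_of_le_of_lt (mul_le_mul_of_nonneg_right h4 ha3) h3
  -- ceiling: `√(1 + a² + b²) + 1/2 ≤ 1.4143 b`, `√3 ≥ 1.732`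
  have hsq : Real.sqrt (1 + a ^ 2 + b ^ 2) ≤ 1.4143 * b - 1 / 2 := by
    have hy : 0 ≤ 1.4143 * b - 1 / 2 := by linarith
    calc Real.sqrt (1 + a ^ 2 + b ^ 2) ≤ Real.sqrt ((1.4143 * b - 1 / 2) ^ 2) :=
          Real.sqrt_le_sqrt (by rw [hab]; nlinarith [hb])
      _ = 1.4143 * b - 1 / 2 := Real.sqrt_sq hy
  have hquot : (Real.sqrt (1 + a ^ 2 + b ^ 2) + 1 / 2) / Real.sqrt 3 ≤ 1.4143 * b / 1.732 :=
    div_le_div₀ (by linarith) (by linarith) (by norm_num) sqrt_three_ge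
  have hT1 : T ≤ 2 * (1.4143 * b / 1.732) ^ 3 := by
    rw [hT_def]
    have := pow_le_pow_left₀ hq0 hquot 3
    linarith
  -- `a ≥ (12/13) b`
  have ha1213 : 12 * b / 13 ≤ a := by rw [hab]; linarith
  have hcube : (12 * b / 13) ^ 3 ≤ a ^ 3 := pow_le_pow_left₀ (by positivity) ha1213 3
  have key : (1.6817 : ℝ) * (12 * b / 13) ^ 3 < 2 * (1.4143 * b / 1.732) ^ 3 := by
    calc (1.6817 : ℝ) * (12 * b / 13) ^ 3 ≤ 1.6817 * a ^ 3 :=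
          mul_le_mul_of_nonneg_left hcube (by norm_num)
      _ < T := h5
      _ ≤ 2 * (1.4143 * b / 1.732) ^ 3 := hT1
  have key' : (1.6817 : ℝ) * (12 / 13) ^ 3 * b ^ 3 < 2 * (1.4143 / 1.732) ^ 3 * b ^ 3 := by
    have e1 : (1.6817 : ℝ) * (12 * b / 13) ^ 3 = 1.6817 * (12 / 13) ^ 3 * b ^ 3 := by ring
    have e2 : (2 : ℝ) * (1.4143 * b / 1.732) ^ 3 = 2 * (1.4143 / 1.732) ^ 3 * b ^ 3 := by ring
    rw [← e1, ← e2]; exact key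
  have hb3 : 0 < b ^ 3 := by positivity
  have := lt_of_mul_lt_mul_right key' hb3.le
  norm_num at this

/-! ## The witnesses -/

variable {l : ℕ}

/-- **NO LEVEL-ONE WITNESS OVER `𝔽_3` IN DIMENSION `≥ 3`** (`l ≥ 2`, `0 < ε ≤ 2`). -/
theorem no_levelOne_witness_pThree (hl : 2 ≤ l) {ε : ℝ} (hε : 0 < ε) (hε2 : ε ≤ 2)
    {H₁ H₂ H₃ : Subgroup (GLm 3 (1 + l))} (htpp : SubgroupTPP H₁ H₂ H₃)
    (hdes : ∃ c : Mat 3 (1 + l) → ℂ, (∀ M, 1 < M.rank → c M = 0) ∧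
      (∑ M, c M * ZMod.stdAddChar (Matrix.trace (M * ((1 : GLm 3 (1 + l)) : Mat 3 (1 + l))))) = 1 ∧
      ∀ a ∈ H₁, ∀ b ∈ H₂, ∀ g ∈ H₃, a * b * g ≠ 1 →
        (∑ M, c M * ZMod.stdAddChar
          (Matrix.trace (M * ((a * b * g : GLm 3 (1 + l)) : Mat 3 (1 + l))))) = 0) :
    ¬ budget 3 (1 + l) 1 (2 + ε) <
      ((Nat.card H₁ * Nat.card H₂ * Nat.card H₃ : ℕ) : ℝ) ^ ((2 + ε) / 3) := by
  intro hlt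
  have hM := levelOne_neumann_master (p := 3) (l := l) (by omega) hε htpp hdes hlt
  set a : ℝ := ((((3 : ℕ) : ℝ)) ^ (1 + l) - ((3 : ℕ) : ℝ)) / (((3 : ℕ) : ℝ) - 1) with ha_def
  set b : ℝ := ((((3 : ℕ) : ℝ)) ^ (1 + l) - 1) / (((3 : ℕ) : ℝ) - 1) with hb_def
  have h32 : ((3 : ℕ) : ℝ) - 2 = 1 := by norm_num
  simp only [h32, one_mul] at hM
  have h27 : (27 : ℝ) ≤ (3 : ℝ) ^ (1 + l) := by
    have h := pow_le_pow_right₀ (show (1 : ℝ) ≤ 3 by norm_num) (show 3 ≤ 1 + l by omega)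
    norm_num at h
    exact h
  have hb13 : 13 ≤ b := by
    rw [hb_def]
    push_cast
    rw [le_div_iff₀ (by norm_num)]
    linarith
  have hab : a = b - 1 := by
    rw [ha_def, hb_def]
    push_cast
    ring
  exact pThree_core hb13 hab (by linarith) (by linarith) hM

/-- **NO LEVEL-ONE WITNESS IN `GL₂(𝔽_3)`, ANY `ε > 0`**: the volume law gives `V ≤ 60` (`D ≤ 26`,
`u ≤ 5`), the floor `V^{s/3} > 4^s` gives `V > 64`. -/
theorem no_levelOne_witness_pThree_dimTwo {ε : ℝ} (hε : 0 < ε)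
    {H₁ H₂ H₃ : Subgroup (GLm 3 (1 + 1))} (htpp : SubgroupTPP H₁ H₂ H₃)
    (hdes : ∃ c : Mat 3 (1 + 1) → ℂ, (∀ M, 1 < M.rank → c M = 0) ∧
      (∑ M, c M * ZMod.stdAddChar (Matrix.trace (M * ((1 : GLm 3 (1 + 1)) : Mat 3 (1 + 1))))) = 1 ∧
      ∀ a ∈ H₁, ∀ b ∈ H₂, ∀ g ∈ H₃, a * b * g ≠ 1 →
        (∑ M, c M * ZMod.stdAddChar
          (Matrix.trace (M * ((a * b * g : GLm 3 (1 + 1)) : Mat 3 (1 + 1))))) = 0) :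
    ¬ budget 3 (1 + 1) 1 (2 + ε) <
      ((Nat.card H₁ * Nat.card H₂ * Nat.card H₃ : ℕ) : ℝ) ^ ((2 + ε) / 3) := by
  intro hlt
  obtain ⟨u, hu1, -, -, -, huu, hvol⟩ := crux_volume_law (k := 1) htpp hdes
  have hD := finrank_le_formula_nat (p := 3) (l := 1)
  have hb4 : (3 ^ (1 + 1) - 1) / (3 - 1) = 4 := by norm_num
  rw [hb4] at hD
  -- floor `V > 64`
  have hfl := (budget_ge_exact (p := 3) (l := 1) (by norm_num) (2 + ε)).trans_lt hlt
  set s : ℝ := 2 + ε with hs_def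
  have hs : 0 < s := by rw [hs_def]; linarith
  have ea : ((((3 : ℕ) : ℝ)) ^ (1 + 1) - ((3 : ℕ) : ℝ)) / (((3 : ℕ) : ℝ) - 1) = 3 := by norm_num
  have eb : ((((3 : ℕ) : ℝ)) ^ (1 + 1) - 1) / (((3 : ℕ) : ℝ) - 1) = 4 := by norm_num
  have h32 : ((3 : ℕ) : ℝ) - 2 = 1 := by norm_num
  rw [ea, eb, h32, one_mul] at hfl
  generalize Nat.card H₁ * Nat.card H₂ * Nat.card H₃ = V at hfl hvol
  have h3s : 0 ≤ (3 : ℝ) ^ s := Real.rpow_nonneg (by norm_num) s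
  have h4s : 1 * (4 : ℝ) ^ s < (V : ℝ) ^ (s / 3) := by linarith
  have h64 := cube_lt_of_rpow_lt (by norm_num) (by norm_num) (Nat.cast_nonneg V) hs h4s
  rw [Real.one_rpow, one_mul] at h64
  norm_num at h64
  have hV : 64 < V := by exact_mod_cast h64
  -- ceiling `V ≤ 60`
  generalize finrank ℂ (levelSubmodule 3 (1 + 1) 1) = D at hD huu hvol
  norm_num at hD
  have hu : u ≤ 5 := by
    by_contra h
    have h6 : 6 ≤ u := by omega
    have h36 : 6 * 6 ≤ u * u := Nat.mul_le_mul h6 h6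
    omega
  interval_cases u <;> omega

/-- **`p = 3`: THE LEVEL-ONE SLICE OF THE CRUX IS EMPTY IN EVERY DIMENSION `m ≥ 2` FOR EVERY
`0 < ε ≤ 2`** (crux clause verbatim, `k = 1`). -/
theorem no_crux_instance_pThree_all {ε : ℝ} (hε : 0 < ε) (hε2 : ε ≤ 2) :
    ¬ ∃ (m : ℕ) (_ : 2 ≤ m)
      (H₁ H₂ H₃ : Subgroup (Matrix.GeneralLinearGroup (Fin m) (ZMod 3))),
      Literature.Barriers.MatrixMultiplication.SubgroupTPP H₁ H₂ H₃ ∧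
      (∃ c : Matrix (Fin m) (Fin m) (ZMod 3) → ℂ, (∀ M, 1 < M.rank → c M = 0) ∧
        (∑ M : Matrix (Fin m) (Fin m) (ZMod 3), c M * ZMod.stdAddChar
          (Matrix.trace (M * ((1 : Matrix.GeneralLinearGroup (Fin m) (ZMod 3)) :
            Matrix (Fin m) (Fin m) (ZMod 3))))) = 1 ∧
        ∀ a ∈ H₁, ∀ b ∈ H₂, ∀ g ∈ H₃, a * b * g ≠ 1 →
          (∑ M : Matrix (Fin m) (Fin m) (ZMod 3), c M * ZMod.stdAddChar
            (Matrix.trace (M * ((a * b * g : Matrix.GeneralLinearGroup (Fin m) (ZMod 3)) :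
              Matrix (Fin m) (Fin m) (ZMod 3))))) = 0) ∧
      (∑ᶠ χ ∈ Literature.RepresentationTheory.FiniteGroups.irrChars
          (Matrix.GeneralLinearGroup (Fin m) (ZMod 3)) ∩
          {f | ∃ c : Matrix (Fin m) (Fin m) (ZMod 3) → ℂ, (∀ M, 1 < M.rank → c M = 0) ∧
            ∀ g : Matrix.GeneralLinearGroup (Fin m) (ZMod 3), f g =
              ∑ M : Matrix (Fin m) (Fin m) (ZMod 3), c M * ZMod.stdAddChar
                (Matrix.trace (M * (g : Matrix (Fin m) (Fin m) (ZMod 3))))},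
        (χ 1).re ^ (2 + ε)) <
        ((Nat.card H₁ * Nat.card H₂ * Nat.card H₃ : ℕ) : ℝ) ^ ((2 + ε) / 3) := by
  rintro ⟨m, hm, H₁, H₂, H₃, htpp, hdesign, hlt⟩
  obtain ⟨l, rfl⟩ : ∃ l, m = 1 + l := ⟨m - 1, by omega⟩
  rcases Nat.lt_or_ge l 2 with h1 | h2
  · obtain rfl : l = 1 := by omega
    exact no_levelOne_witness_pThree_dimTwo hε htpp hdesign hlt
  · exact no_levelOne_witness_pThree h2 hε hε2 htpp hdesign hlt

end PThreeAllDimensions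

end Summit.MatrixMultiplication.MatrixMultiplication.Theorems.SubgroupIdentityDesigns.Negative
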